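import Literature.NumberTheory.Automorphic.HeckeTransversalGL                     -- ★ transversal `rep (S,ā) = u_ā ϖ^{ε_S}` of `K t_r K / K`, `bijOn_heckeTransversal`, `sum_transversalIndex_of_fst`
import Literature.NumberTheory.Automorphic.CartanDecompositionGLnUnique           -- ★ `exists_glInt_mul_zpowDiagGL_mul_eq_iff` (`ϖ^b ∈ K ϖ^a K ⟺ b ~ a`), `permGL_mul_zpowDiagGL_mul_inv`
import Summits.HodgeConjecture.HodgeConjecture.Theorems.R90S6LatticeInvCalculus   -- ★ L1 `relPos`, `relPos_eq_iff` (bridge to the lattice reading only)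
import HarnessLib

/-!
# R90 · S6 — card L3, FILE 1 (MASTER, all `n`, `r`): the neighbour counts `#{γK₀ ⊆ K₀t_rK₀ : γ⁻¹ϖ^λ ∈ K₀ϖ^μK₀}` (row E1.4.4.2.3, count half of W10-f)

Seat `R90-C14-p10 (g0)`, helper for `stmt-HodgeConjecture-24833` (h413); junction letters agreed with `R90-C14-p06 (g0)` on the R90 bus
(2026-09-05 01:00Z / 01:04Z): for `K₀ = glInt n K = GL_n(𝒪)`, `t_r = heckeDiag n ϖ r = diag(ϖ1_r, 1_{n−r})`, `ϖ^λ = zpowDiagGL λ`,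

  `pieriCount r μ λ = ({γ ∈ K₀·(t_rK₀) | (γ.out⁻¹ ϖ^λ)K₀ ∈ K₀·(ϖ^μK₀)}).ncard`

(no new definition: the set-builder `ncard` is written out in every statement) — the coefficient of `c_λ = [K₀ϖ^λK₀]` in `c_μ · T_r`
(p06's (H.0), from ★ `HeckeAlgebraStructureConstants.card_pairs_eq_card_inv_mul_mem`), i.e. the number of `r`-neighbours `Λ′`
(`Λ₀ ⊋ Λ′ ⊋ ϖΛ₀`, `Λ₀/Λ′ ≅ 𝓀^r`) of `Λ₀ = 𝒪^n` whose position relative to `ϖ^λΛ₀` is `μ` (`relPos`, §4) — the Hall number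
`g^λ_{μ(1^r)}(q)` of Macdonald II (4.6) / V (2.6).

## The key identity (§1)

For EVERY element `y = u_ā ϖ^{ε_S}` of the ★ transversal of `K₀t_rK₀/K₀` (`HeckeTransversalGL`: pivot set `S`, `#S = n − r`, reduced
echelon table `ā` supported on `{(i,j) : i < j, i ∉ S, j ∈ S}`) and every MONOTONE exponent `ν` (`ν₀ ≤ ⋯ ≤ ν_{n−1}`):
  `y⁻¹ · ϖ^ν · u_b = ϖ^{ν − ε_S}`,  `u_b ∈ K₀` the echelon unipotent with `b_{ij} = a_{ij} ϖ^{ν_j − ν_i}` (integral BECAUSE `i < j`),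
so the elementary divisors of `y⁻¹ϖ^ν` are `ν − ε_S` whatever `ā` is (`exists_rep_inv_mul_zpowDiagGL_mul_eq`). Hence (§2) the MASTER COUNT,
for all `n`, `r ≤ n`, `μ` arbitrary and `ν` monotone (`q = #𝓀`, `c(S) = #echelonPositions S = #{(i,j) : i<j, i∉S, j∈S}`):
  `pieriCount r μ ν = Σ_{S ⊆ Fin n, #S = n − r} [μ is a permutation of ν − ε_S] · q^{c(S)}`
(`ncard_pieri_eq_sum`), its permutation invariances in `λ` and `μ` (§3, so antitone `λ` as the dealer prints them are covered:
`ncard_pieri_eq_sum_of_antitone`) and the lattice reading (§4). FILE 2 (`R90S6GLThreePieriCounts`) evaluates the sum at `n = 3`,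
`r ∈ {1, 2}`: the dealt EXPLICIT VALUES `{1, q, q+1, q², q²+q, q²+q+1}` on the vertical strips and `0` elsewhere.
## References
* [Macdonald1995] I. G. Macdonald, *Symmetric Functions and Hall Polynomials*, 2nd ed. (1995), Ch. II (4.2)–(4.6) (PDF p. 164), Ch. V (2.6).
* [ShimuraIATAF1971] G. Shimura, *Introduction to the Arithmetic Theory of Automorphic Functions* (1971), §3.2, Lemma 3.22 and its proof.
-/

set_option autoImplicit false
-- the mandated namespace repeats the single-problem summit's segment (`HodgeConjecture.HodgeConjecture`)
set_option linter.dupNamespace false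

noncomputable section
open scoped MatrixGroups
open MulAction ValuativeRel Matrix Finset Literature.NumberTheory.Automorphic Literature.NumberTheory.Automorphic.Echelon
  Literature.LinearAlgebra.Matrix.Echelon

namespace Summit.HodgeConjecture.HodgeConjecture.R90.S6

/-! ## §0 Orbits in `GL_n(K)/K₀` versus double cosets -/

section Orbit

variable {K : Type*} [Field K] [ValuativeRel K] {n : ℕ}

/-- **`xK₀ ∈ K₀·(yK₀) ⟺ K₀xK₀ = K₀yK₀`**: membership of a coset in a `K₀`-orbit of `GL_n(K)/K₀` is the double-coset relation
`k₁ x k₂ = y` (`k₁, k₂ ∈ K₀ = GL_n(𝒪)`). [cite: ShimuraIATAF1971, §3.1 (3.1.1)] -/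
theorem mk_mem_orbit_mk_iff (x y : GL (Fin n) K) :
    ((x : GL (Fin n) K ⧸ glInt n K) ∈ MulAction.orbit (glInt n K) ((y : GL (Fin n) K) : GL (Fin n) K ⧸ glInt n K)) ↔
      ∃ k₁ ∈ glInt n K, ∃ k₂ ∈ glInt n K, k₁ * x * k₂ = y := by
  constructor
  · rintro ⟨⟨k, hk⟩, e⟩
    change (k : GL (Fin n) K) • ((y : GL (Fin n) K) : GL (Fin n) K ⧸ glInt n K) = _ at e
    rw [MulAction.Quotient.smul_mk, smul_eq_mul, QuotientGroup.eq] at e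
    exact ⟨k⁻¹, (glInt n K).inv_mem hk, ((k * y)⁻¹ * x)⁻¹, (glInt n K).inv_mem e, by group⟩
  · rintro ⟨k₁, hk₁, k₂, hk₂, e⟩
    refine ⟨⟨k₁⁻¹, (glInt n K).inv_mem hk₁⟩, ?_⟩
    change (k₁⁻¹ : GL (Fin n) K) • ((y : GL (Fin n) K) : GL (Fin n) K ⧸ glInt n K) = _
    rw [MulAction.Quotient.smul_mk, smul_eq_mul, QuotientGroup.eq, ← e, show (k₁⁻¹ * (k₁ * x * k₂))⁻¹ * x = k₂⁻¹ by group]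
    exact (glInt n K).inv_mem hk₂

/-- Left multiplication by `κ ∈ K₀` does not change the `K₀`-orbit: `(κx)K₀ ∈ K₀·(zK₀) ⟺ xK₀ ∈ K₀·(zK₀)`. [folklore] -/
theorem mk_mul_mem_orbit_iff {κ : GL (Fin n) K} (hκ : κ ∈ glInt n K) (x z : GL (Fin n) K) :
    (((κ * x : GL (Fin n) K)) : GL (Fin n) K ⧸ glInt n K) ∈ MulAction.orbit (glInt n K) ((z : GL (Fin n) K) : GL (Fin n) K ⧸ glInt n K) ↔
      ((x : GL (Fin n) K ⧸ glInt n K) ∈ MulAction.orbit (glInt n K) ((z : GL (Fin n) K) : GL (Fin n) K ⧸ glInt n K)) := by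
  rw [mk_mem_orbit_mk_iff, mk_mem_orbit_mk_iff]
  constructor
  · rintro ⟨k₁, hk₁, k₂, hk₂, e⟩
    exact ⟨k₁ * κ, (glInt n K).mul_mem hk₁ hκ, k₂, hk₂, by rw [← e]; group⟩
  · rintro ⟨k₁, hk₁, k₂, hk₂, e⟩
    exact ⟨k₁ * κ⁻¹, (glInt n K).mul_mem hk₁ ((glInt n K).inv_mem hκ), k₂, hk₂, by rw [← e]; group⟩

/-- Right multiplication by `κ ∈ K₀` inside the tested element: `((xκ)⁻¹g)K₀ ∈ K₀·(zK₀) ⟺ (x⁻¹g)K₀ ∈ K₀·(zK₀)` — the predicate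
`γ ↦ [(γ.out⁻¹ g)K₀ ∈ K₀·(zK₀)]` does not depend on the representative of `γ = xK₀`. [folklore] -/
theorem mul_inv_mul_mem_orbit_iff {κ : GL (Fin n) K} (hκ : κ ∈ glInt n K) (x g z : GL (Fin n) K) :
    ((((x * κ)⁻¹ * g : GL (Fin n) K)) : GL (Fin n) K ⧸ glInt n K) ∈ MulAction.orbit (glInt n K) ((z : GL (Fin n) K) : GL (Fin n) K ⧸ glInt n K) ↔
      (((x⁻¹ * g : GL (Fin n) K)) : GL (Fin n) K ⧸ glInt n K) ∈ MulAction.orbit (glInt n K) ((z : GL (Fin n) K) : GL (Fin n) K ⧸ glInt n K) := by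
  rw [_root_.mul_inv_rev, mul_assoc]
  exact mk_mul_mem_orbit_iff ((glInt n K).inv_mem hκ) _ _

/-- The `.out` form: for `γ = yK₀`, `(γ.out⁻¹ g)K₀ ∈ K₀·(zK₀) ⟺ (y⁻¹ g)K₀ ∈ K₀·(zK₀)`. [folklore] -/
theorem out_inv_mul_mem_orbit_iff (y g z : GL (Fin n) K) :
    (((((y : GL (Fin n) K ⧸ glInt n K).out)⁻¹ * g : GL (Fin n) K)) : GL (Fin n) K ⧸ glInt n K) ∈
        MulAction.orbit (glInt n K) ((z : GL (Fin n) K) : GL (Fin n) K ⧸ glInt n K) ↔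
      (((y⁻¹ * g : GL (Fin n) K)) : GL (Fin n) K ⧸ glInt n K) ∈ MulAction.orbit (glInt n K) ((z : GL (Fin n) K) : GL (Fin n) K ⧸ glInt n K) := by
  obtain ⟨κ, hκ⟩ := QuotientGroup.mk_out_eq_mul (glInt n K) y
  rw [hκ]
  exact mul_inv_mul_mem_orbit_iff κ.2 _ _ _

/-- `K₀`-translates stay in the orbit: `κ•γ ∈ K₀·(zK₀) ⟺ γ ∈ K₀·(zK₀)` for `κ ∈ K₀`. [folklore] -/
theorem smul_mem_orbit_iff_of_mem_glInt {κ : GL (Fin n) K} (hκ : κ ∈ glInt n K) (γ : GL (Fin n) K ⧸ glInt n K) (z : GL (Fin n) K) :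
    (κ • γ ∈ MulAction.orbit (glInt n K) ((z : GL (Fin n) K) : GL (Fin n) K ⧸ glInt n K)) ↔
      γ ∈ MulAction.orbit (glInt n K) ((z : GL (Fin n) K) : GL (Fin n) K ⧸ glInt n K) := by
  obtain ⟨x, rfl⟩ := QuotientGroup.mk_surjective γ
  rw [MulAction.Quotient.smul_mk, smul_eq_mul]
  exact mk_mul_mem_orbit_iff hκ _ _

end Orbit

/-! ## §1 The key identity: elementary divisors of `rep(S,ā)⁻¹ ϖ^ν` are `ν − ε_S` -/

section Key

variable {K : Type*} [Field K] [ValuativeRel K] {n : ℕ} {ϖ : K}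

/-- **KEY IDENTITY.** For a transversal index `p = (S, ā)` of `K₀ t_r K₀ / K₀` (★ `HeckeTransversalGL`, `rep p = u_ā ϖ^{ε_S}`) and a
MONOTONE exponent vector `ν`, there is `u ∈ K₀` with `(rep p)⁻¹ · ϖ^ν · u = ϖ^{ν − ε_S}`: `u = u_b` is the echelon unipotent with
`b_{ij} = a_{ij} ϖ^{ν_j − ν_i}` — integral since `ā` is supported on `i < j` — and `ϖ^ν u_b = u_ā ϖ^ν`. So the elementary divisors of
`(rep p)⁻¹ϖ^ν` are `ν − ε_S`, independently of `ā`. [cite: Macdonald1995, Ch. II (4.2)–(4.6); Ch. V (2.6)] [cite: ShimuraIATAF1971, §3.2, proof of Lemma 3.22] -/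
theorem exists_rep_inv_mul_zpowDiagGL_mul_eq (hϖ : IsUniformizingElement ϖ) {r : ℕ} (p : TransversalIndex n K r) {ν : Fin n → ℤ}
    (hν : Monotone ν) :
    ∃ u ∈ glInt n K, (p.rep hϖ.ne_zero)⁻¹ * zpowDiagGL hϖ.ne_zero ν * u = zpowDiagGL hϖ.ne_zero (fun i => ν i - (epsOf p.1.1 i : ℤ)) := by
  obtain ⟨⟨S, ā⟩, hS, h⟩ := p
  -- the rescaled table `b`
  set b : Fin n → Fin n → K := fun i j => liftTable ā i j * ϖ ^ (ν j - ν i) with hb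
  have hb0 : ∀ i j, ā i j = 0 → b i j = 0 := fun i j h0 => by
    simp only [hb, liftTable_eq_zero_iff.mpr h0, zero_mul]
  have hbsupp : ∀ i j, b i j ≠ 0 → i < j := fun i j hij => (h i j fun h0 => hij (hb0 i j h0)).1
  have hdet : (echelonMatrix b).det = 1 := det_echelonMatrix hbsupp
  -- `u_b` as an element of `GL_n(K)` and of `K₀`
  let u : GL (Fin n) K := Matrix.GeneralLinearGroup.mkOfDetNeZero (echelonMatrix b) (by rw [hdet]; exact one_ne_zero)
  have hu_coe : ((u : GL (Fin n) K) : Matrix (Fin n) (Fin n) K) = echelonMatrix b := rfl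
  have hu : u ∈ glInt n K := by
    refine mem_glInt_of_isIntegralMatrix (fun i j => ?_) (by rw [hu_coe, hdet, map_one])
    rw [hu_coe]
    by_cases hij : i = j
    · subst hij
      rw [echelonMatrix_apply_self]
      exact Subring.one_mem _
    · rw [echelonMatrix_apply_of_ne _ hij]
      by_cases h0 : ā i j = 0
      · rw [hb0 i j h0]
        exact Subring.zero_mem _
      · have hlt : i < j := (h i j h0).1
        have hle : ν i ≤ ν j := hν hlt.le
        refine Subring.mul_mem _ (liftTable_mem ā i j) ?_
        rw [show ν j - ν i = ((ν j - ν i).toNat : ℤ) by omega, zpow_natCast]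
        exact Subring.pow_mem _ hϖ.mem _
  refine ⟨u, hu, ?_⟩
  -- the identity `ϖ^ν u_b = u_ā ϖ^{ε_S} ϖ^{ν − ε_S}`
  rw [mul_assoc, inv_mul_eq_iff_eq_mul]
  refine Units.ext ?_
  change ((zpowDiagGL hϖ.ne_zero ν : GL (Fin n) K) : Matrix (Fin n) (Fin n) K) * echelonMatrix b =
    heckeRepMatrix ϖ S ā * ((zpowDiagGL hϖ.ne_zero (fun i => ν i - (epsOf S i : ℤ)) : GL (Fin n) K) : Matrix (Fin n) (Fin n) K)
  rw [coe_zpowDiagGL, coe_zpowDiagGL, heckeRepMatrix, piPow, Matrix.mul_assoc, Matrix.diagonal_mul_diagonal]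
  ext i j
  rw [Matrix.diagonal_mul, Matrix.mul_diagonal, ← zpow_natCast, ← zpow_add₀ hϖ.ne_zero, add_sub_cancel]
  by_cases hij : i = j
  · subst hij
    rw [echelonMatrix_apply_self, echelonMatrix_apply_self, mul_one, one_mul]
  · rw [echelonMatrix_apply_of_ne _ hij, echelonMatrix_apply_of_ne _ hij, hb]
    simp only
    rw [mul_left_comm, ← zpow_add₀ hϖ.ne_zero, add_sub_cancel]

variable [IsDiscreteValuationRing 𝒪[K]]

/-- **THE COSET `(rep p)⁻¹ϖ^ν K₀` LIES IN `K₀·(ϖ^μK₀)` IFF `μ` IS A PERMUTATION OF `ν − ε_S`** (`ν` monotone, `μ` arbitrary): the key identity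
and the uniqueness of Cartan exponents (★ `CartanUnique.exists_glInt_mul_zpowDiagGL_mul_eq_iff`). [cite: Macdonald1995, Ch. V (2.2), (2.6)] -/
theorem rep_inv_mul_zpowDiagGL_mem_orbit_iff (hϖ : IsUniformizingElement ϖ) {r : ℕ} (p : TransversalIndex n K r) {ν : Fin n → ℤ}
    (hν : Monotone ν) (μ : Fin n → ℤ) :
    ((((p.rep hϖ.ne_zero)⁻¹ * zpowDiagGL hϖ.ne_zero ν : GL (Fin n) K)) : GL (Fin n) K ⧸ glInt n K) ∈
        MulAction.orbit (glInt n K) (((zpowDiagGL hϖ.ne_zero μ : GL (Fin n) K)) : GL (Fin n) K ⧸ glInt n K) ↔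
      ∃ σ : Equiv.Perm (Fin n), ∀ i, μ (σ i) = ν i - (epsOf p.1.1 i : ℤ) := by
  obtain ⟨u, hu, e⟩ := exists_rep_inv_mul_zpowDiagGL_mul_eq hϖ p hν
  have e' : (p.rep hϖ.ne_zero)⁻¹ * zpowDiagGL hϖ.ne_zero ν = zpowDiagGL hϖ.ne_zero (fun i => ν i - (epsOf p.1.1 i : ℤ)) * u⁻¹ := by
    rw [← e, mul_inv_cancel_right]
  rw [mk_mem_orbit_mk_iff, e']
  refine Iff.trans ?_ (CartanUnique.exists_glInt_mul_zpowDiagGL_mul_eq_iff hϖ (a := fun i => ν i - (epsOf p.1.1 i : ℤ)) (b := μ))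
  constructor
  · rintro ⟨k₁, hk₁, k₂, hk₂, h⟩
    exact ⟨k₁, hk₁, u⁻¹ * k₂, (glInt n K).mul_mem ((glInt n K).inv_mem hu) hk₂, by rw [← h]; group⟩
  · rintro ⟨k₁, hk₁, k₂, hk₂, h⟩
    exact ⟨k₁, hk₁, u * k₂, (glInt n K).mul_mem hu hk₂, by rw [← h]; group⟩

end Key

/-! ## §2 The master count -/

section Master

variable {K : Type*} [Field K] [ValuativeRel K] {n : ℕ} [IsDiscreteValuationRing 𝒪[K]] [Finite 𝓀[K]] {ϖ : K}

/-- **MASTER COUNT, TRANSVERSAL FORM.** For `ν` monotone and any `μ`: the number of elements `y` of the ★ transversal of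
`K₀t_rK₀/K₀` with `(y⁻¹ϖ^ν)K₀ ∈ K₀·(ϖ^μK₀)` is `Σ_{S ⊆ Fin n, #S = n−r} [μ ~ ν − ε_S]·q^{c(S)}`, `q = #𝓀`,
`c(S) = #echelonPositions S` (★ `sum_transversalIndex_of_fst`). [cite: Macdonald1995, Ch. II (4.6); Ch. V (2.6)] -/
theorem card_filter_heckeTransversal_eq_sum (hϖ : IsUniformizingElement ϖ) (r : ℕ) {ν : Fin n → ℤ} (hν : Monotone ν) (μ : Fin n → ℤ)
    [DecidablePred fun z : GL (Fin n) K ⧸ glInt n K =>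
      z ∈ MulAction.orbit (glInt n K) (((zpowDiagGL hϖ.ne_zero μ : GL (Fin n) K)) : GL (Fin n) K ⧸ glInt n K)] :
    ((heckeTransversal (n := n) hϖ.ne_zero r).filter fun y : GL (Fin n) K =>
        (((y⁻¹ * zpowDiagGL hϖ.ne_zero ν : GL (Fin n) K)) : GL (Fin n) K ⧸ glInt n K) ∈
          MulAction.orbit (glInt n K) (((zpowDiagGL hϖ.ne_zero μ : GL (Fin n) K)) : GL (Fin n) K ⧸ glInt n K)).card =
      ∑ S ∈ (Finset.univ : Finset (Finset (Fin n))).filter (fun S => S.card = n - r),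
        if ∃ σ : Equiv.Perm (Fin n), ∀ i, μ (σ i) = ν i - (epsOf S i : ℤ) then Nat.card 𝓀[K] ^ (echelonPositions S).card else 0 := by
  classical
  haveI : Fintype 𝓀[K] := Fintype.ofFinite _
  set P : GL (Fin n) K → Prop := fun y => (((y⁻¹ * zpowDiagGL hϖ.ne_zero ν : GL (Fin n) K)) : GL (Fin n) K ⧸ glInt n K) ∈
    MulAction.orbit (glInt n K) (((zpowDiagGL hϖ.ne_zero μ : GL (Fin n) K)) : GL (Fin n) K ⧸ glInt n K) with hP
  have hT : (heckeTransversal (n := n) hϖ.ne_zero r).filter P =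
      ((Finset.univ : Finset (TransversalIndex n K r)).filter fun p => P (p.rep hϖ.ne_zero)).image (TransversalIndex.rep hϖ.ne_zero) := by
    ext y
    simp only [Finset.mem_filter, Finset.mem_image, Finset.mem_univ, true_and, mem_heckeTransversal_iff]
    constructor
    · rintro ⟨⟨p, rfl⟩, hy⟩
      exact ⟨p, hy, rfl⟩
    · rintro ⟨p, hp, rfl⟩
      exact ⟨⟨p, rfl⟩, hp⟩
  rw [hT, Finset.card_image_of_injective _ (TransversalIndex.rep_injective hϖ), Finset.card_filter]
  have key : ∀ p : TransversalIndex n K r, P (p.rep hϖ.ne_zero) ↔ ∃ σ : Equiv.Perm (Fin n), ∀ i, μ (σ i) = ν i - (epsOf p.1.1 i : ℤ) :=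
    fun p => rep_inv_mul_zpowDiagGL_mem_orbit_iff hϖ p hν μ
  calc (∑ p : TransversalIndex n K r, if P (p.rep hϖ.ne_zero) then 1 else 0)
      = ∑ p : TransversalIndex n K r, (fun S : Finset (Fin n) =>
          if ∃ σ : Equiv.Perm (Fin n), ∀ i, μ (σ i) = ν i - (epsOf S i : ℤ) then 1 else 0) p.1.1 :=
        Finset.sum_congr rfl fun p _ => if_congr (key p) rfl rfl
    _ = _ := by
        refine (sum_transversalIndex_of_fst (n := n) (F := K) r (fun S : Finset (Fin n) =>
          if ∃ σ : Equiv.Perm (Fin n), ∀ i, μ (σ i) = ν i - (epsOf S i : ℤ) then 1 else 0)).trans ?_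
        refine Finset.sum_congr rfl fun S _ => ?_
        rw [Nat.card_eq_fintype_card, smul_eq_mul, mul_ite, mul_one, mul_zero]

/-- **MASTER COUNT (the junction letter agreed with R90-C14-p06).** For `r ≤ n`, `ν` MONOTONE and any `μ`:
`#{γ ∈ K₀·(t_rK₀) : (γ.out⁻¹ϖ^ν)K₀ ∈ K₀·(ϖ^μK₀)} = Σ_{S ⊆ Fin n, #S = n−r} [μ is a permutation of ν − ε_S]·q^{c(S)}` — the number of
`r`-neighbours of `𝒪^n` in position `μ` relative to `ϖ^ν𝒪^n`, i.e. the coefficient of `c_ν` in `c_μ·T_r` (Hall number `g^ν_{μ(1^r)}(q)`).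
[cite: Macdonald1995, Ch. II (4.6); Ch. V (2.6)] [cite: ShimuraIATAF1971, Lemma 3.22] -/
theorem ncard_pieri_eq_sum (hϖ : IsUniformizingElement ϖ) {r : ℕ} (hr : r ≤ n) {ν : Fin n → ℤ} (hν : Monotone ν) (μ : Fin n → ℤ) :
    {γ ∈ MulAction.orbit (glInt n K) (((heckeDiag n (Units.mk0 ϖ hϖ.ne_zero) r : GL (Fin n) K)) : GL (Fin n) K ⧸ glInt n K) |
        ((((γ.out)⁻¹ * zpowDiagGL hϖ.ne_zero ν : GL (Fin n) K)) : GL (Fin n) K ⧸ glInt n K) ∈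
          MulAction.orbit (glInt n K) (((zpowDiagGL hϖ.ne_zero μ : GL (Fin n) K)) : GL (Fin n) K ⧸ glInt n K)}.ncard =
      ∑ S ∈ (Finset.univ : Finset (Finset (Fin n))).filter (fun S => S.card = n - r),
        if ∃ σ : Equiv.Perm (Fin n), ∀ i, μ (σ i) = ν i - (epsOf S i : ℤ) then Nat.card 𝓀[K] ^ (echelonPositions S).card else 0 := by
  classical
  rw [← card_filter_heckeTransversal_eq_sum hϖ r hν μ]
  have hbij := bijOn_heckeTransversal (n := n) hϖ hr
  set Q : GL (Fin n) K → Prop := fun y => (((y⁻¹ * zpowDiagGL hϖ.ne_zero ν : GL (Fin n) K)) : GL (Fin n) K ⧸ glInt n K) ∈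
    MulAction.orbit (glInt n K) (((zpowDiagGL hϖ.ne_zero μ : GL (Fin n) K)) : GL (Fin n) K ⧸ glInt n K) with hQ
  have hset : {γ ∈ MulAction.orbit (glInt n K) (((heckeDiag n (Units.mk0 ϖ hϖ.ne_zero) r : GL (Fin n) K)) : GL (Fin n) K ⧸ glInt n K) |
        ((((γ.out)⁻¹ * zpowDiagGL hϖ.ne_zero ν : GL (Fin n) K)) : GL (Fin n) K ⧸ glInt n K) ∈
          MulAction.orbit (glInt n K) (((zpowDiagGL hϖ.ne_zero μ : GL (Fin n) K)) : GL (Fin n) K ⧸ glInt n K)} =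
      ↑(((heckeTransversal (n := n) hϖ.ne_zero r).filter Q).image fun y : GL (Fin n) K => (y : GL (Fin n) K ⧸ glInt n K)) := by
    ext γ
    simp only [Set.mem_setOf_eq, Finset.coe_image, Finset.coe_filter, Set.mem_image]
    constructor
    · rintro ⟨hγ, hPγ⟩
      obtain ⟨y, hy, rfl⟩ := hbij.surjOn hγ
      exact ⟨y, ⟨hy, (out_inv_mul_mem_orbit_iff y _ _).1 hPγ⟩, rfl⟩
    · rintro ⟨y, ⟨hy, hQy⟩, rfl⟩
      exact ⟨hbij.mapsTo hy, (out_inv_mul_mem_orbit_iff y _ _).2 hQy⟩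
  rw [hset, Set.ncard_coe_finset, Finset.card_image_of_injOn (hbij.injOn.mono (Finset.coe_subset.2 (Finset.filter_subset _ _)))]

/-- **SUPPORT.** If some `r`-neighbour lies in position `μ` relative to `ϖ^ν𝒪^n` (`ν` monotone), then `μ` is a permutation of `ν − ε_S` for a
pivot set `S` with `#S = n − r`; in particular `ν − μ` is, up to reordering, a `0/1`-vector with `r` ones («`λ − μ` is a vertical `r`-strip»).
[cite: Macdonald1995, Ch. II (4.4)–(4.6)] -/
theorem exists_perm_of_ncard_pieri_ne_zero (hϖ : IsUniformizingElement ϖ) {r : ℕ} (hr : r ≤ n) {ν : Fin n → ℤ} (hν : Monotone ν)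
    (μ : Fin n → ℤ)
    (h : {γ ∈ MulAction.orbit (glInt n K) (((heckeDiag n (Units.mk0 ϖ hϖ.ne_zero) r : GL (Fin n) K)) : GL (Fin n) K ⧸ glInt n K) |
        ((((γ.out)⁻¹ * zpowDiagGL hϖ.ne_zero ν : GL (Fin n) K)) : GL (Fin n) K ⧸ glInt n K) ∈
          MulAction.orbit (glInt n K) (((zpowDiagGL hϖ.ne_zero μ : GL (Fin n) K)) : GL (Fin n) K ⧸ glInt n K)}.ncard ≠ 0) :
    ∃ S : Finset (Fin n), S.card = n - r ∧ ∃ σ : Equiv.Perm (Fin n), ∀ i, μ (σ i) = ν i - (epsOf S i : ℤ) := by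
  classical
  rw [ncard_pieri_eq_sum hϖ hr hν μ] at h
  obtain ⟨S, hS, hne⟩ := Finset.exists_ne_zero_of_sum_ne_zero h
  refine ⟨S, (Finset.mem_filter.1 hS).2, ?_⟩
  by_contra hσ
  exact hne (if_neg hσ)

end Master

/-! ## §3 Permutation invariance; the antitone form of the master count -/

section Perm

variable {K : Type*} [Field K] [ValuativeRel K] {n : ℕ} {ϖ : K}

/-- Twisting by a permutation matrix: `((P_σ•γ).out⁻¹ ϖ^{λ∘σ})K₀ ∈ K₀·(ϖ^μK₀) ⟺ (γ.out⁻¹ϖ^λ)K₀ ∈ K₀·(ϖ^μK₀)` (`P_σ ϖ^λ P_σ⁻¹ = ϖ^{λ∘σ}`,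
★ `CartanUnique.permGL_mul_zpowDiagGL_mul_inv`; `P_σ ∈ K₀`). [cite: Macdonald1995, Ch. V §2, before (2.2)] -/
theorem perm_smul_pred_iff (hϖ0 : ϖ ≠ 0) (σ : Equiv.Perm (Fin n)) (γ : GL (Fin n) K ⧸ glInt n K) (lam μ : Fin n → ℤ) :
    ((((((permGL σ : GL (Fin n) K) • γ).out)⁻¹ * zpowDiagGL hϖ0 (lam ∘ σ) : GL (Fin n) K)) : GL (Fin n) K ⧸ glInt n K) ∈
        MulAction.orbit (glInt n K) (((zpowDiagGL hϖ0 μ : GL (Fin n) K)) : GL (Fin n) K ⧸ glInt n K) ↔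
      ((((γ.out)⁻¹ * zpowDiagGL hϖ0 lam : GL (Fin n) K)) : GL (Fin n) K ⧸ glInt n K) ∈
        MulAction.orbit (glInt n K) (((zpowDiagGL hϖ0 μ : GL (Fin n) K)) : GL (Fin n) K ⧸ glInt n K) := by
  obtain ⟨g, rfl⟩ := QuotientGroup.mk_surjective γ
  rw [MulAction.Quotient.smul_mk, smul_eq_mul, out_inv_mul_mem_orbit_iff, out_inv_mul_mem_orbit_iff,
    ← CartanUnique.permGL_mul_zpowDiagGL_mul_inv hϖ0 σ lam,
    show ((permGL σ : GL (Fin n) K) * g)⁻¹ * ((permGL σ : GL (Fin n) K) * zpowDiagGL hϖ0 lam * (permGL σ)⁻¹) =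
      g⁻¹ * zpowDiagGL hϖ0 lam * (permGL σ)⁻¹ by group,
    show ((((g⁻¹ * zpowDiagGL hϖ0 lam * (permGL σ)⁻¹ : GL (Fin n) K)) : GL (Fin n) K ⧸ glInt n K)) =
      (((g⁻¹ * zpowDiagGL hϖ0 lam : GL (Fin n) K)) : GL (Fin n) K ⧸ glInt n K) from
        QuotientGroup.eq.2 (by
          rw [show (g⁻¹ * zpowDiagGL hϖ0 lam * (permGL σ)⁻¹)⁻¹ * (g⁻¹ * zpowDiagGL hϖ0 lam) = permGL σ by group]
          exact permGL_mem_glInt σ)]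

/-- **PERMUTATION INVARIANCE IN `λ`**: `#{γ ∈ K₀·(t_rK₀) : (γ.out⁻¹ϖ^{λ∘σ})K₀ ∈ K₀·(ϖ^μK₀)} = #{γ ∈ K₀·(t_rK₀) : (γ.out⁻¹ϖ^λ)K₀ ∈ K₀·(ϖ^μK₀)}` —
the second set is carried onto the first by `γ ↦ P_σ•γ`. [cite: Macdonald1995, Ch. V §2 (2.2)] -/
theorem ncard_pieri_comp_perm (hϖ : IsUniformizingElement ϖ) (r : ℕ) (σ : Equiv.Perm (Fin n)) (lam μ : Fin n → ℤ) :
    {γ ∈ MulAction.orbit (glInt n K) (((heckeDiag n (Units.mk0 ϖ hϖ.ne_zero) r : GL (Fin n) K)) : GL (Fin n) K ⧸ glInt n K) |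
        ((((γ.out)⁻¹ * zpowDiagGL hϖ.ne_zero (lam ∘ σ) : GL (Fin n) K)) : GL (Fin n) K ⧸ glInt n K) ∈
          MulAction.orbit (glInt n K) (((zpowDiagGL hϖ.ne_zero μ : GL (Fin n) K)) : GL (Fin n) K ⧸ glInt n K)}.ncard =
      {γ ∈ MulAction.orbit (glInt n K) (((heckeDiag n (Units.mk0 ϖ hϖ.ne_zero) r : GL (Fin n) K)) : GL (Fin n) K ⧸ glInt n K) |
        ((((γ.out)⁻¹ * zpowDiagGL hϖ.ne_zero lam : GL (Fin n) K)) : GL (Fin n) K ⧸ glInt n K) ∈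
          MulAction.orbit (glInt n K) (((zpowDiagGL hϖ.ne_zero μ : GL (Fin n) K)) : GL (Fin n) K ⧸ glInt n K)}.ncard := by
  have hP : (permGL σ : GL (Fin n) K) ∈ glInt n K := permGL_mem_glInt σ
  have hset :
      {γ ∈ MulAction.orbit (glInt n K) (((heckeDiag n (Units.mk0 ϖ hϖ.ne_zero) r : GL (Fin n) K)) : GL (Fin n) K ⧸ glInt n K) |
        ((((γ.out)⁻¹ * zpowDiagGL hϖ.ne_zero (lam ∘ σ) : GL (Fin n) K)) : GL (Fin n) K ⧸ glInt n K) ∈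
          MulAction.orbit (glInt n K) (((zpowDiagGL hϖ.ne_zero μ : GL (Fin n) K)) : GL (Fin n) K ⧸ glInt n K)} =
      (fun γ => (permGL σ : GL (Fin n) K) • γ) ''
        {γ ∈ MulAction.orbit (glInt n K) (((heckeDiag n (Units.mk0 ϖ hϖ.ne_zero) r : GL (Fin n) K)) : GL (Fin n) K ⧸ glInt n K) |
          ((((γ.out)⁻¹ * zpowDiagGL hϖ.ne_zero lam : GL (Fin n) K)) : GL (Fin n) K ⧸ glInt n K) ∈
            MulAction.orbit (glInt n K) (((zpowDiagGL hϖ.ne_zero μ : GL (Fin n) K)) : GL (Fin n) K ⧸ glInt n K)} := by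
    ext γ'
    simp only [Set.mem_setOf_eq, Set.mem_image]
    constructor
    · rintro ⟨h1, h2⟩
      refine ⟨(permGL σ : GL (Fin n) K)⁻¹ • γ', ⟨?_, ?_⟩, smul_inv_smul _ _⟩
      · exact (smul_mem_orbit_iff_of_mem_glInt ((glInt n K).inv_mem hP) γ' _).2 h1
      · rw [← perm_smul_pred_iff hϖ.ne_zero σ _ lam μ, smul_inv_smul]
        exact h2
    · rintro ⟨γ, ⟨h1, h2⟩, rfl⟩
      exact ⟨(smul_mem_orbit_iff_of_mem_glInt hP γ _).2 h1, (perm_smul_pred_iff hϖ.ne_zero σ γ lam μ).2 h2⟩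
  rw [hset, Set.ncard_image_of_injective _ (MulAction.injective (permGL σ : GL (Fin n) K))]

/-- **PERMUTATION INVARIANCE IN `μ`**: `K₀·(ϖ^{μ∘σ}K₀) = K₀·(ϖ^μK₀)` (the orbit only sees the double coset). [cite: Macdonald1995, Ch. V §2 (2.2)] -/
theorem orbit_zpowDiagGL_comp_perm (hϖ0 : ϖ ≠ 0) (σ : Equiv.Perm (Fin n)) (μ : Fin n → ℤ) :
    MulAction.orbit (glInt n K) (((zpowDiagGL hϖ0 (μ ∘ σ) : GL (Fin n) K)) : GL (Fin n) K ⧸ glInt n K) =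
      MulAction.orbit (glInt n K) (((zpowDiagGL hϖ0 μ : GL (Fin n) K)) : GL (Fin n) K ⧸ glInt n K) := by
  rw [← CartanUnique.permGL_mul_zpowDiagGL_mul_inv hϖ0 σ μ]
  have h1 : ((((permGL σ : GL (Fin n) K) * zpowDiagGL hϖ0 μ * (permGL σ)⁻¹ : GL (Fin n) K)) : GL (Fin n) K ⧸ glInt n K) =
      (⟨permGL σ, permGL_mem_glInt σ⟩ : glInt n K) • (((zpowDiagGL hϖ0 μ : GL (Fin n) K)) : GL (Fin n) K ⧸ glInt n K) := by
    rw [show (⟨permGL σ, permGL_mem_glInt σ⟩ : glInt n K) • (((zpowDiagGL hϖ0 μ : GL (Fin n) K)) : GL (Fin n) K ⧸ glInt n K) =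
        (permGL σ : GL (Fin n) K) • (((zpowDiagGL hϖ0 μ : GL (Fin n) K)) : GL (Fin n) K ⧸ glInt n K) from rfl,
      MulAction.Quotient.smul_mk, smul_eq_mul]
    exact QuotientGroup.eq.2 (by
      rw [show ((permGL σ : GL (Fin n) K) * zpowDiagGL hϖ0 μ * (permGL σ)⁻¹)⁻¹ * (permGL σ * zpowDiagGL hϖ0 μ) = permGL σ by group]
      exact permGL_mem_glInt σ)
  rw [h1, MulAction.orbit_smul]

variable [IsDiscreteValuationRing 𝒪[K]] [Finite 𝓀[K]]

/-- **MASTER COUNT, ANTITONE FORM** (exponents `λ₀ ≥ ⋯ ≥ λ_{n−1}` as the route prints them): for `r ≤ n`, `λ` antitone, `μ` arbitrary,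
`#{γ ∈ K₀·(t_rK₀) : (γ.out⁻¹ϖ^λ)K₀ ∈ K₀·(ϖ^μK₀)} = Σ_{#S = n−r} [μ is a permutation of (λ∘rev) − ε_S]·q^{c(S)}`.
[cite: Macdonald1995, Ch. II (4.6); Ch. V (2.6)] -/
theorem ncard_pieri_eq_sum_of_antitone (hϖ : IsUniformizingElement ϖ) {r : ℕ} (hr : r ≤ n) {lam : Fin n → ℤ} (hlam : Antitone lam)
    (μ : Fin n → ℤ) :
    {γ ∈ MulAction.orbit (glInt n K) (((heckeDiag n (Units.mk0 ϖ hϖ.ne_zero) r : GL (Fin n) K)) : GL (Fin n) K ⧸ glInt n K) |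
        ((((γ.out)⁻¹ * zpowDiagGL hϖ.ne_zero lam : GL (Fin n) K)) : GL (Fin n) K ⧸ glInt n K) ∈
          MulAction.orbit (glInt n K) (((zpowDiagGL hϖ.ne_zero μ : GL (Fin n) K)) : GL (Fin n) K ⧸ glInt n K)}.ncard =
      ∑ S ∈ (Finset.univ : Finset (Finset (Fin n))).filter (fun S => S.card = n - r),
        if ∃ σ : Equiv.Perm (Fin n), ∀ i, μ (σ i) = lam (Fin.rev i) - (epsOf S i : ℤ) then Nat.card 𝓀[K] ^ (echelonPositions S).card
        else 0 := by
  have hν : Monotone (lam ∘ Fin.rev) := fun i j hij => hlam (Fin.rev_le_rev.2 hij)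
  have e : lam = (lam ∘ Fin.rev) ∘ ⇑(Fin.revPerm : Equiv.Perm (Fin n)) := by
    funext i
    simp only [Function.comp_apply, Fin.revPerm_apply, Fin.rev_rev]
  calc _ = {γ ∈ MulAction.orbit (glInt n K) (((heckeDiag n (Units.mk0 ϖ hϖ.ne_zero) r : GL (Fin n) K)) : GL (Fin n) K ⧸ glInt n K) |
        ((((γ.out)⁻¹ * zpowDiagGL hϖ.ne_zero ((lam ∘ Fin.rev) ∘ ⇑(Fin.revPerm : Equiv.Perm (Fin n))) : GL (Fin n) K)) :
            GL (Fin n) K ⧸ glInt n K) ∈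
          MulAction.orbit (glInt n K) (((zpowDiagGL hϖ.ne_zero μ : GL (Fin n) K)) : GL (Fin n) K ⧸ glInt n K)}.ncard := by
        rw [← e]
    _ = _ := ncard_pieri_comp_perm hϖ r Fin.revPerm _ μ
    _ = _ := ncard_pieri_eq_sum hϖ hr hν μ

end Perm

/-! ## §4 The lattice reading: `relPos` (★ L1) -/

section RelPos

variable {K : Type*} [Field K] [ValuativeRel K] {n : ℕ} [IsDiscreteValuationRing 𝒪[K]] {ϖ : K}

/-- **BRIDGE TO THE RELATIVE POSITION.** For `μ` ANTITONE: `(y⁻¹ϖ^λ)K₀ ∈ K₀·(ϖ^μK₀) ⟺ relPos hϖ y ϖ^λ = μ` — the tested coset condition says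
exactly that the lattice `y·𝒪^n` sits in position `μ` relative to `ϖ^λ·𝒪^n` (★ L1 `relPos_eq_iff`). With `y = γ.out` this identifies the junction
count with the dealer's `#{Λ′ : Λ₀ ⊋ Λ′ ⊋ ϖΛ₀, Λ₀/Λ′ ≅ 𝓀^r, relPos(Λ′, ϖ^λΛ₀) = μ}`. [cite: Macdonald1995, Ch. V §2 (2.2), (2.6)] -/
theorem inv_mul_zpowDiagGL_mem_orbit_iff_relPos_eq (hϖ : IsUniformizingElement ϖ) (y : GL (Fin n) K) (lam : Fin n → ℤ) {μ : Fin n → ℤ}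
    (hμ : Antitone μ) :
    ((((y⁻¹ * zpowDiagGL hϖ.ne_zero lam : GL (Fin n) K)) : GL (Fin n) K ⧸ glInt n K) ∈
        MulAction.orbit (glInt n K) (((zpowDiagGL hϖ.ne_zero μ : GL (Fin n) K)) : GL (Fin n) K ⧸ glInt n K)) ↔
      relPos hϖ y (zpowDiagGL hϖ.ne_zero lam) = μ := by
  rw [mk_mem_orbit_mk_iff, relPos_eq_iff]
  exact ⟨fun h => ⟨hμ, h⟩, fun h => h.2⟩

/-- The junction set in `relPos` currency: for `μ` antitone the two set-builders coincide. [cite: Macdonald1995, Ch. V §2 (2.6)] -/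
theorem pieriSet_eq_relPos (hϖ : IsUniformizingElement ϖ) (r : ℕ) (lam : Fin n → ℤ) {μ : Fin n → ℤ} (hμ : Antitone μ) :
    {γ ∈ MulAction.orbit (glInt n K) (((heckeDiag n (Units.mk0 ϖ hϖ.ne_zero) r : GL (Fin n) K)) : GL (Fin n) K ⧸ glInt n K) |
        ((((γ.out)⁻¹ * zpowDiagGL hϖ.ne_zero lam : GL (Fin n) K)) : GL (Fin n) K ⧸ glInt n K) ∈
          MulAction.orbit (glInt n K) (((zpowDiagGL hϖ.ne_zero μ : GL (Fin n) K)) : GL (Fin n) K ⧸ glInt n K)} =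
      {γ ∈ MulAction.orbit (glInt n K) (((heckeDiag n (Units.mk0 ϖ hϖ.ne_zero) r : GL (Fin n) K)) : GL (Fin n) K ⧸ glInt n K) |
        relPos hϖ γ.out (zpowDiagGL hϖ.ne_zero lam) = μ} := by
  ext γ
  simp only [Set.mem_setOf_eq, inv_mul_zpowDiagGL_mem_orbit_iff_relPos_eq hϖ _ lam hμ]

end RelPos

end Summit.HodgeConjecture.HodgeConjecture.R90.S6
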